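import Summits.Ventures.PercRepro.C025ProfileRankFourCertB

/-!
# The rank-4 certificate: (Dem)(a) — a rank-2 set with at least three points receives its demand (night-3 g7)

NIGHT3-G7-RANK4-CERTIFICATE.md §2(a), in the kernel: for a rank-2 set `B` with `|B| ≥ 3` and `p := ρ(E∖B) ≥ 3`, the
one-extra-point supersets `B ∪ {y}`, `y ∉ cl B`, already pay `Σ_y p/(r_y + 1 − j) ≥ p` (`r_y := ρ(E ∖ (B ∪ y))`,
`j := min(2, |cl B| − |B|)`): with `F := E ∖ cl B`, `T := cl B ∖ B`, submodularity gives `p ≤ ρ(F) + ρ(T) ≤ |F| + j`; if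
`|F| ≥ p + 1 − j` every term is `≥ p/(p + 1 − j)` (`r_y ≤ p`); otherwise `|F| = p − j`, `F` is independent, and
`r_y ≤ ρ(F ∖ y) + ρ(T) ≤ p − 1` makes every term `≥ p/(p − j)`, so the sum is `≥ p` exactly. No rank-4 hypothesis is
needed for this case — it holds in every finite matroid (and is stated so).
-/

open scoped Matroid

namespace PercRepro

open Set Finset ThmH

section DemA

variable {α : Type} [DecidableEq α] {M : Matroid α} [M.Finite]

omit [DecidableEq α] in
/-- `B ⊆ clF M B` for `B ⊆ gr M`. -/
theorem subset_clF_self {B : Finset α} (hB : B ⊆ gr M) : B ⊆ clF M B := by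
  intro x hx
  rw [← Finset.mem_coe, coe_clF]
  exact M.subset_closure _ (by rw [← coe_gr]; exact_mod_cast hB) (by exact_mod_cast hx)

omit [DecidableEq α] in
/-- `clF M B ⊆ gr M`. -/
theorem clF_subset_gr (B : Finset α) : clF M B ⊆ gr M := by
  intro x hx
  rw [← Finset.mem_coe, coe_clF] at hx
  rw [← Finset.mem_coe, coe_gr]
  exact M.closure_subset_ground _ hx

omit [DecidableEq α] in
/-- The rank of the closure of a rank-`2` set is `2`. -/
theorem eRk_clF_of_eRk_two {B : Finset α} (h2 : M.eRk (B : Set α) = 2) : M.eRk ((clF M B : Finset α) : Set α) = 2 := by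
  rw [coe_clF, M.eRk_closure_eq, h2]

/-- The complement of `B` in the ground set is `(gr M ∖ clF M B) ∪ (clF M B ∖ B)`. -/
theorem gr_sdiff_eq_union {B : Finset α} (hB : B ⊆ gr M) :
    gr M \ B = (gr M \ clF M B) ∪ (clF M B \ B) := by
  ext x
  simp only [Finset.mem_sdiff, Finset.mem_union]
  constructor
  · rintro ⟨hx, hxB⟩
    by_cases hc : x ∈ clF M B
    · exact Or.inr ⟨hc, hxB⟩
    · exact Or.inl ⟨hx, hc⟩
  · rintro (⟨hx, hc⟩ | ⟨hc, hxB⟩)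
    · exact ⟨hx, fun h => hc (subset_clF_self hB h)⟩
    · exact ⟨clF_subset_gr B hc, hxB⟩

/-- `ρ(T) ≤ j(B)` for `T = clF M B ∖ B` and a rank-`2` set `B`. -/
theorem eRk_clF_sdiff_le_jB {B : Finset α} (hB : B ⊆ gr M) (h2 : M.eRk (B : Set α) = 2) :
    M.eRk ((clF M B \ B : Finset α) : Set α) ≤ (jB M B : ℕ∞) := by
  have hfin : M.eRk ((clF M B \ B : Finset α) : Set α) ≠ ⊤ := by
    rw [← lt_top_iff_ne_top]; exact (M.isRkFinite_set _).eRk_lt_top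
  have h1 : M.eRk ((clF M B \ B : Finset α) : Set α) ≤ 2 := by
    rw [← eRk_clF_of_eRk_two h2]
    exact M.eRk_mono (Finset.coe_subset.2 Finset.sdiff_subset)
  have h2' : M.eRk ((clF M B \ B : Finset α) : Set α) ≤ ((clF M B \ B).card : ℕ∞) := by
    rw [← Set.encard_coe_eq_coe_finsetCard]; exact M.eRk_le_encard _
  have hc : (clF M B \ B).card = (clF M B).card - B.card := Finset.card_sdiff_of_subset (subset_clF_self hB)
  unfold jB
  rw [← hc]
  rcases le_or_gt 2 (clF M B \ B).card with h | h
  · rw [min_eq_left h]; exact h1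
  · rw [min_eq_right h.le]; exact h2'

/-- In a simple matroid, `j(B) ≤ ρ(clF M B ∖ B)` (two points of a line are independent). -/
theorem jB_le_eRk_clF_sdiff (hsimple : ∀ T ⊆ M.E, T.encard ≤ 2 → M.Indep T) {B : Finset α} (hB : B ⊆ gr M) :
    (jB M B : ℕ∞) ≤ M.eRk ((clF M B \ B : Finset α) : Set α) := by
  have hc : (clF M B \ B).card = (clF M B).card - B.card := Finset.card_sdiff_of_subset (subset_clF_self hB)
  have hTg : clF M B \ B ⊆ gr M := Finset.sdiff_subset.trans (clF_subset_gr B)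
  unfold jB
  rw [← hc]
  -- a subset of size min 2 |T| of T is independent
  obtain ⟨U, hUT, hUc⟩ := Finset.exists_subset_card_eq (show min 2 (clF M B \ B).card ≤ (clF M B \ B).card from min_le_right _ _)
  have hUE : (U : Set α) ⊆ M.E := by rw [← coe_gr]; exact_mod_cast hUT.trans hTg
  have hind : M.Indep (U : Set α) := hsimple _ hUE (by
    rw [Set.encard_coe_eq_coe_finsetCard, hUc]; exact_mod_cast min_le_left _ _)
  calc ((min 2 (clF M B \ B).card : ℕ) : ℕ∞) = (U : Set α).encard := by
        rw [Set.encard_coe_eq_coe_finsetCard, hUc]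
    _ = M.eRk (U : Set α) := hind.eRk_eq_encard.symm
    _ ≤ M.eRk ((clF M B \ B : Finset α) : Set α) := M.eRk_mono (Finset.coe_subset.2 hUT)

/-- **(Dem)(a) and (b)**: in a simple matroid, a rank-`2` set `B` with `ρ(E∖B) ≥ 3` and either `|B| ≥ 3` or `j(B) = 0`
(a pair on a two-point line) receives at least `ρ(E∖B)` from its one-extra-point supersets under `w4n`. -/
theorem dem_w4n_of_three_le_card_or_jB_zero (hsimple : ∀ T ⊆ M.E, T.encard ≤ 2 → M.Indep T) {B : Finset α}
    (hB : B ∈ Profile.Rq M 2) (hcase : 3 ≤ B.card ∨ jB M B = 0) (hp : 3 ≤ crk M B) :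
    (crk M B : ℚ) ≤ ∑ S ∈ (Shadow.levelSet M 3).filter (fun S => B ⊆ S), w4n M B S := by
  classical
  rw [Profile.mem_Rq] at hB
  obtain ⟨hBg, hB2⟩ := hB
  set L := clF M B with hL
  set F := gr M \ L with hF
  set T := L \ B with hT
  set p := crk M B with hpdef
  set j := jB M B with hjdef
  have hBL : B ⊆ L := subset_clF_self hBg
  have hLg : L ⊆ gr M := clF_subset_gr B
  have hFT : gr M \ B = F ∪ T := gr_sdiff_eq_union hBg
  have hdisj : Disjoint F T := by
    rw [Finset.disjoint_left]; intro x hx hxT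
    exact (Finset.mem_sdiff.1 hx).2 (Finset.mem_sdiff.1 hxT).1
  -- the rank of the complement, in ℕ∞ and in ℕ
  have hpfin : M.eRk ((gr M \ B : Finset α) : Set α) ≠ ⊤ := by
    rw [← lt_top_iff_ne_top]; exact (M.isRkFinite_set _).eRk_lt_top
  have hpE : M.eRk ((gr M \ B : Finset α) : Set α) = (p : ℕ∞) := by
    rw [hpdef]; unfold crk; rw [ENat.coe_toNat hpfin]
  -- (F1): p ≤ ρ(F) + j, hence (F2): p ≤ |F| + j
  have hTj : M.eRk ((T : Finset α) : Set α) ≤ (j : ℕ∞) := eRk_clF_sdiff_le_jB hBg hB2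
  have hF1 : (p : ℕ∞) ≤ M.eRk ((F : Finset α) : Set α) + (j : ℕ∞) := by
    rw [← hpE, hFT, Finset.coe_union]
    calc M.eRk ((F : Finset α) ∪ (T : Finset α) : Set α) ≤ M.eRk (F : Set α) + M.eRk (T : Set α) :=
          M.eRk_union_le_eRk_add_eRk _ _
      _ ≤ M.eRk (F : Set α) + (j : ℕ∞) := add_le_add_right hTj _
  have hFcard : M.eRk ((F : Finset α) : Set α) ≤ (F.card : ℕ∞) := by
    rw [← Set.encard_coe_eq_coe_finsetCard]; exact M.eRk_le_encard _
  have hF2 : p ≤ F.card + j := by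
    have : (p : ℕ∞) ≤ (F.card : ℕ∞) + (j : ℕ∞) := hF1.trans (add_le_add_left hFcard _)
    exact_mod_cast this
  have hj2 : j ≤ 2 := by rw [hjdef]; unfold jB; exact min_le_left _ _
  -- the one-extra-point supersets: y ∈ F ↦ insert y B
  have hmem : ∀ y ∈ F, insert y B ∈ (Shadow.levelSet M 3).filter (fun S => B ⊆ S) := by
    intro y hy
    rw [hF, Finset.mem_sdiff] at hy
    have hyE : y ∈ M.E := by rw [← coe_gr]; exact_mod_cast hy.1
    have hycl : y ∉ M.closure (B : Set α) := by
      intro h; apply hy.2; rw [hL, ← Finset.mem_coe, coe_clF]; exact h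
    rw [Finset.mem_filter, Profile.mem_levelSet]
    refine ⟨⟨Finset.insert_subset hy.1 hBg, ?_⟩, Finset.subset_insert _ _⟩
    rw [Finset.coe_insert, M.eRk_insert_eq_add_one ⟨hyE, hycl⟩, hB2]; rfl
  have hinj : Set.InjOn (fun y => insert y B) (F : Set α) := by
    intro y hy y' hy' h
    simp only at h
    rw [Finset.mem_coe, hF, Finset.mem_sdiff] at hy hy'
    have hyB : y ∉ B := fun hh => hy.2 (hBL hh)
    have hy'B : y' ∉ B := fun hh => hy'.2 (hBL hh)
    have : y ∈ insert y' B := by rw [← h]; exact Finset.mem_insert_self _ _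
    rw [Finset.mem_insert] at this
    rcases this with h' | h'
    · exact h'
    · exact absurd h' hyB
  have hsub : F.image (fun y => insert y B) ⊆ (Shadow.levelSet M 3).filter (fun S => B ⊆ S) := by
    intro S hS; rw [Finset.mem_image] at hS; obtain ⟨y, hy, rfl⟩ := hS; exact hmem y hy
  have hlow : ∑ y ∈ F, w4n M B (insert y B) ≤ ∑ S ∈ (Shadow.levelSet M 3).filter (fun S => B ⊆ S), w4n M B S := by
    rw [← Finset.sum_image hinj]
    exact Finset.sum_le_sum_of_subset_of_nonneg hsub (fun S _ _ => w4n_nonneg B S)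
  -- the value of each term
  have hval : ∀ y ∈ F, w4n M B (insert y B) =
      (p : ℚ) / ((crk M (insert y B) : ℚ) + 1 - (j : ℚ)) ∧
      (j : ℕ) ≤ crk M (insert y B) ∧ crk M (insert y B) ≤ p := by
    intro y hy
    have hyF := hy
    rw [hF, Finset.mem_sdiff] at hyF
    have hyB : y ∉ B := fun hh => hyF.2 (hBL hh)
    have hsd : (insert y B \ B).card = 1 := by
      rw [Finset.insert_sdiff_of_notMem _ hyB, Finset.sdiff_self, Finset.insert_empty, Finset.card_singleton]
    have hrfin : M.eRk ((gr M \ insert y B : Finset α) : Set α) ≠ ⊤ := by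
      rw [← lt_top_iff_ne_top]; exact (M.isRkFinite_set _).eRk_lt_top
    have hcompl : gr M \ insert y B = (F.erase y) ∪ T := by
      ext x
      simp only [Finset.mem_sdiff, Finset.mem_insert, Finset.mem_union, Finset.mem_erase, not_or]
      constructor
      · rintro ⟨hx, hxy, hxB⟩
        by_cases hc : x ∈ L
        · exact Or.inr (by rw [hT, Finset.mem_sdiff]; exact ⟨hc, hxB⟩)
        · exact Or.inl ⟨hxy, by rw [hF, Finset.mem_sdiff]; exact ⟨hx, hc⟩⟩
      · rintro (⟨hxy, hxF⟩ | hxT)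
        · rw [hF, Finset.mem_sdiff] at hxF
          exact ⟨hxF.1, hxy, fun h => hxF.2 (hBL h)⟩
        · rw [hT, Finset.mem_sdiff] at hxT
          refine ⟨hLg hxT.1, ?_, hxT.2⟩
          rintro rfl; exact hyF.2 hxT.1
    -- j ≤ r_y: T ⊆ the complement
    have hrge : (j : ℕ∞) ≤ M.eRk ((gr M \ insert y B : Finset α) : Set α) := by
      calc (j : ℕ∞) ≤ M.eRk ((T : Finset α) : Set α) := by rw [hjdef, hT, hL]; exact jB_le_eRk_clF_sdiff hsimple hBg
        _ ≤ M.eRk ((gr M \ insert y B : Finset α) : Set α) :=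
            M.eRk_mono (by rw [hcompl, Finset.coe_union]; exact Set.subset_union_right)
    have hrle : M.eRk ((gr M \ insert y B : Finset α) : Set α) ≤ (p : ℕ∞) := by
      rw [← hpE]
      exact M.eRk_mono (Finset.coe_subset.2 (Finset.sdiff_subset_sdiff (subset_refl _) (Finset.subset_insert _ _)))
    have hrgeN : j ≤ crk M (insert y B) := by
      unfold crk; rw [← ENat.coe_toNat hrfin] at hrge; exact_mod_cast hrge
    have hrleN : crk M (insert y B) ≤ p := by
      unfold crk; rw [← ENat.coe_toNat hrfin] at hrle; exact_mod_cast hrle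
    refine ⟨?_, hrgeN, hrleN⟩
    -- evaluate the rule
    have hpos : (0 : ℚ) < (crk M (insert y B) : ℚ) + 1 - (j : ℚ) := by
      have : (j : ℚ) ≤ (crk M (insert y B) : ℚ) := by exact_mod_cast hrgeN
      linarith
    have hw : w4 M B (insert y B) = (p : ℚ) / ((crk M (insert y B) : ℚ) + 1 - (j : ℚ)) := by
      unfold w4
      simp only
      rw [if_neg (by omega : ¬ crk M B < 3), if_pos hsd]
      by_cases hB3 : 3 ≤ B.card
      · rw [if_pos hB3]
      · have hj0 : jB M B = 0 := by
          rcases hcase with h | h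
          · exact absurd h hB3
          · exact h
        rw [if_neg hB3, if_pos hj0]
        have : (j : ℚ) = 0 := by rw [hjdef, hj0]; simp
        rw [this, hpdef]; ring
    unfold w4n
    rw [hw, max_eq_right (div_nonneg (by positivity) hpos.le)]
  -- the sum over F
  have hFpos : 0 < F.card := by
    by_contra h0
    push Not at h0
    have : F = ∅ := Finset.card_eq_zero.1 (Nat.le_zero.1 h0)
    -- then p ≤ j ≤ 2 < 3
    have : p ≤ j := by rw [this, Finset.card_empty] at hF2; simpa using hF2
    omega
  have hjp : j < p := by omega
  rcases le_or_gt (p + 1 - j) F.card with hbig | hsmall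
  · -- every term ≥ p/(p+1−j)
    have hterm : ∀ y ∈ F, (p : ℚ) / ((p : ℚ) + 1 - (j : ℚ)) ≤ w4n M B (insert y B) := by
      intro y hy
      obtain ⟨hv, hge, hle⟩ := hval y hy
      rw [hv]
      have hd1 : (0 : ℚ) < (crk M (insert y B) : ℚ) + 1 - (j : ℚ) := by
        have : (j : ℚ) ≤ (crk M (insert y B) : ℚ) := by exact_mod_cast hge
        linarith
      have hd2 : (crk M (insert y B) : ℚ) + 1 - (j : ℚ) ≤ (p : ℚ) + 1 - (j : ℚ) := by
        have : (crk M (insert y B) : ℚ) ≤ (p : ℚ) := by exact_mod_cast hle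
        linarith
      exact div_le_div_of_nonneg_left (by positivity) hd1 hd2
    have hsum : ∑ y ∈ F, (p : ℚ) / ((p : ℚ) + 1 - (j : ℚ)) ≤ ∑ y ∈ F, w4n M B (insert y B) := Finset.sum_le_sum hterm
    rw [Finset.sum_const, nsmul_eq_mul] at hsum
    have hbig' : ((p + 1 - j : ℕ) : ℚ) ≤ (F.card : ℚ) := by exact_mod_cast hbig
    have hcast : ((p + 1 - j : ℕ) : ℚ) = (p : ℚ) + 1 - (j : ℚ) := by
      rw [Nat.cast_sub (by omega)]; push_cast; ring
    rw [hcast] at hbig'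
    have hdpos : (0 : ℚ) < (p : ℚ) + 1 - (j : ℚ) := by
      have : (j : ℚ) < (p : ℚ) := by exact_mod_cast hjp
      linarith
    have : (p : ℚ) ≤ (F.card : ℚ) * ((p : ℚ) / ((p : ℚ) + 1 - (j : ℚ))) := by
      rw [mul_div_assoc', le_div_iff₀ hdpos]
      nlinarith [hbig']
    linarith
  · -- the tight case: |F| = p − j, F independent, every r_y ≤ p − 1
    have hFeq : F.card = p - j := by omega
    have hFind : M.Indep (F : Set α) := by
      rw [Matroid.indep_iff_eRk_eq_encard_of_finite (Finset.finite_toSet F)]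
      apply le_antisymm (M.eRk_le_encard _)
      rw [Set.encard_coe_eq_coe_finsetCard]
      -- p ≤ ρ(F) + j and |F| = p − j ⟹ |F| ≤ ρ(F)
      have h1 : ((F.card : ℕ) : ℕ∞) + (j : ℕ∞) ≤ M.eRk (F : Set α) + (j : ℕ∞) := by
        have hpj : ((F.card : ℕ) : ℕ∞) + (j : ℕ∞) = (p : ℕ∞) := by
          rw [hFeq]; norm_cast; omega
        rw [hpj]; exact hF1
      exact WithTop.add_le_add_iff_right (ENat.coe_ne_top j) |>.1 h1
    have hterm : ∀ y ∈ F, (p : ℚ) / ((p : ℚ) - (j : ℚ)) ≤ w4n M B (insert y B) := by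
      intro y hy
      obtain ⟨hv, hge, hle⟩ := hval y hy
      -- r_y ≤ p − 1
      have hyF := hy
      rw [hF, Finset.mem_sdiff] at hyF
      have hyB : y ∉ B := fun hh => hyF.2 (hBL hh)
      have hcompl : gr M \ insert y B = (F.erase y) ∪ T := by
        ext x
        simp only [Finset.mem_sdiff, Finset.mem_insert, Finset.mem_union, Finset.mem_erase, not_or]
        constructor
        · rintro ⟨hx, hxy, hxB⟩
          by_cases hc : x ∈ L
          · exact Or.inr (by rw [hT, Finset.mem_sdiff]; exact ⟨hc, hxB⟩)
          · exact Or.inl ⟨hxy, by rw [hF, Finset.mem_sdiff]; exact ⟨hx, hc⟩⟩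
        · rintro (⟨hxy, hxF⟩ | hxT)
          · rw [hF, Finset.mem_sdiff] at hxF
            exact ⟨hxF.1, hxy, fun h => hxF.2 (hBL h)⟩
          · rw [hT, Finset.mem_sdiff] at hxT
            refine ⟨hLg hxT.1, ?_, hxT.2⟩
            rintro rfl; exact hyF.2 hxT.1
      have hrfin : M.eRk ((gr M \ insert y B : Finset α) : Set α) ≠ ⊤ := by
        rw [← lt_top_iff_ne_top]; exact (M.isRkFinite_set _).eRk_lt_top
      have hFy : M.eRk ((F.erase y : Finset α) : Set α) = ((F.card - 1 : ℕ) : ℕ∞) := by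
        rw [(hFind.subset (Finset.coe_subset.2 (Finset.erase_subset _ _))).eRk_eq_encard,
          Set.encard_coe_eq_coe_finsetCard, Finset.card_erase_of_mem hy]
      have hr1 : M.eRk ((gr M \ insert y B : Finset α) : Set α) ≤ ((p - 1 : ℕ) : ℕ∞) := by
        rw [hcompl, Finset.coe_union]
        calc M.eRk ((F.erase y : Finset α) ∪ (T : Finset α) : Set α)
            ≤ M.eRk ((F.erase y : Finset α) : Set α) + M.eRk ((T : Finset α) : Set α) := M.eRk_union_le_eRk_add_eRk _ _
          _ ≤ ((F.card - 1 : ℕ) : ℕ∞) + (j : ℕ∞) := by rw [hFy]; exact add_le_add_right hTj _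
          _ = ((p - 1 : ℕ) : ℕ∞) := by
              rw [hFeq]; norm_cast; omega
      have hr1N : crk M (insert y B) ≤ p - 1 := by
        unfold crk; rw [← ENat.coe_toNat hrfin] at hr1; exact_mod_cast hr1
      rw [hv]
      have hd1 : (0 : ℚ) < (crk M (insert y B) : ℚ) + 1 - (j : ℚ) := by
        have : (j : ℚ) ≤ (crk M (insert y B) : ℚ) := by exact_mod_cast hge
        linarith
      have hd2 : (crk M (insert y B) : ℚ) + 1 - (j : ℚ) ≤ (p : ℚ) - (j : ℚ) := by
        have : ((crk M (insert y B) : ℕ) : ℚ) ≤ ((p - 1 : ℕ) : ℚ) := by exact_mod_cast hr1N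
        rw [Nat.cast_sub (by omega)] at this
        push_cast at this
        linarith
      exact div_le_div_of_nonneg_left (by positivity) hd1 hd2
    have hsum : ∑ y ∈ F, (p : ℚ) / ((p : ℚ) - (j : ℚ)) ≤ ∑ y ∈ F, w4n M B (insert y B) := Finset.sum_le_sum hterm
    rw [Finset.sum_const, nsmul_eq_mul] at hsum
    have hdpos : (0 : ℚ) < (p : ℚ) - (j : ℚ) := by
      have : (j : ℚ) < (p : ℚ) := by exact_mod_cast hjp
      linarith
    have hFq : (F.card : ℚ) = (p : ℚ) - (j : ℚ) := by
      rw [hFeq, Nat.cast_sub hjp.le]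
    have : (F.card : ℚ) * ((p : ℚ) / ((p : ℚ) - (j : ℚ))) = (p : ℚ) := by
      rw [hFq]; field_simp
    linarith

/-- **(Dem)(a)**: the case `|B| ≥ 3`. -/
theorem dem_w4n_of_three_le_card (hsimple : ∀ T ⊆ M.E, T.encard ≤ 2 → M.Indep T) {B : Finset α}
    (hB : B ∈ Profile.Rq M 2) (hB3 : 3 ≤ B.card) (hp : 3 ≤ crk M B) :
    (crk M B : ℚ) ≤ ∑ S ∈ (Shadow.levelSet M 3).filter (fun S => B ⊆ S), w4n M B S :=
  dem_w4n_of_three_le_card_or_jB_zero hsimple hB (Or.inl hB3) hp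

/-- **(Dem)(b)**: the case of a pair on a two-point line (`j(B) = 0`). -/
theorem dem_w4n_of_jB_eq_zero (hsimple : ∀ T ⊆ M.E, T.encard ≤ 2 → M.Indep T) {B : Finset α}
    (hB : B ∈ Profile.Rq M 2) (hj : jB M B = 0) (hp : 3 ≤ crk M B) :
    (crk M B : ℚ) ≤ ∑ S ∈ (Shadow.levelSet M 3).filter (fun S => B ⊆ S), w4n M B S :=
  dem_w4n_of_three_le_card_or_jB_zero hsimple hB (Or.inr hj) hp

end DemA

end PercRepro
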